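import Summits.ResolutionOfSingularities.ResolutionOfSingularities.Theorems.WeightedInvariantHypersurfaceLocalGameEFTPointMoveChart
import Summits.ResolutionOfSingularities.ResolutionOfSingularities.Theorems.WeightedInvariantHypersurfaceLocalGameEFTDimTwoFaceCone
import HarnessLib

/-!
# The e.f.t. local weighted game (H2a′), point moves III: the rank drops when the face polynomial does

Topic: `Summits/ResolutionOfSingularities/ResolutionOfSingularities/Theorems`. Helper for the door item
`HypersurfaceCentreConstruction` (statement `stmt-ResolutionOfSingularities-19897`, route `WeightedInvariant`);
kernel K7a (assembly step shared by cases B and D) of the dim-2 design memo `L/res-type-098-w43/EFT-DIM2-DESIGN.md` v2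
(ORDER (o13) of `res-L1-w43-plan-1`), for THE named rank `ι = iotaOrd`.

[OURS · L1 W4.3] Replaces the role of NO printed item; NOT a statement of the manuscript
[claim: Hironaka2017, status: under-review]. AI work, weaker than expert review.

## Statement proved

Setting of `…EFTPointMoveChart` (p507345): `S` regular local, `u : Fin d → S` a regular system of parameters, positive
weights `w`, a monomial expansion `f = Σ_{α∈Δ} a_α u^α + r` (`r ∈ 𝔪^N`, `m ≤ w·α` on `Δ`, `m < N`) with FACE POLYNOMIAL
`Φ = rho(G) = Σ_{w·α = m} ā_α X^α ∈ κ[X]`. **If `Φ` has order `< ν` at every prime of `κ[X]` off the vertex**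
(`¬ (X₁,…,X_d) ⊆ 𝔫'` ⇒ `Φ ∉ 𝔫'^ν κ[X]_{𝔫'}`; supplied in dimension 2 by res-type-078's K4 `algebraMap_face_notMem_pow` /
`iotaOrd_lt_of_isHomogeneous`, p508084/p508734), **then the successor clause of `LocalWeightedDropEFT` holds at `(S, f)` for
the move `(u, w)` with `ι = iotaOrd` and target value `ν`**: at every prime `𝔫 ∋ t⁻¹`, `𝔫 ⊇ 𝔪B`, off the vertex, and every
factorisation `f = t⁻ᵃ g` with `t⁻¹ ∤ g`, `iotaOrd B_𝔫 g < ν` (`pointMove_iotaOrd_lt_of_face`). Proof: `g = G`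
(`transform_unique`, the face being non-zero), `iotaOrd B_𝔫 g ≤ iotaOrd κ[X]_{rho(𝔫)} Φ` (`iotaOrd_localization_le_of_comap_eq`),
and the hypothesis at `𝔫' = rho(𝔫)` (`not_span_X_le_nbar`).
-/

noncomputable section

open IsLocalRing Literature.AlgebraicGeometry.Resolution
open Summit.ResolutionOfSingularities.ResolutionOfSingularities.Cruxes.HypersurfaceCentreConstruction.LocalEngine
  (iotaOrd)

set_option linter.dupNamespace false -- mandated namespace of this single-conjunct summit

namespace Summit.ResolutionOfSingularities.ResolutionOfSingularities.Theorems

namespace LocalGameEFTPointMove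

variable {S : Type} [CommRing S] [IsRegularLocalRing S] {d : ℕ} (u : Fin d → S) (w : Fin d → ℕ)
  (hu : Ideal.span (Set.range u) = maximalIdeal S) (hd : (maximalIdeal S).spanFinrank = d) (hw : ∀ i, 0 < w i)

include hu hd hw in
/-- **The rank drops at every successor prime when the face polynomial has order `< ν` off the vertex.**
[OURS · L1 W4.3 · K7a] -/
theorem pointMove_iotaOrd_lt_of_face (Δ : Finset (Fin d → ℕ)) (a : (Fin d → ℕ) → S) (m : ℕ) {N : ℕ} (hN : 0 < N)
    {r : S} (hr : r ∈ (maximalIdeal S) ^ N) (hm : ∀ α ∈ Δ, m ≤ ∑ i, w i * α i) (hmN : m < N)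
    {f : S} (hf : f = ∑ α ∈ Δ, a α * ∏ i, u i ^ α i + r) (ν : ℕ)
    (hface : ∀ (𝔫' : Ideal (MvPolynomial (Fin d) (S ⧸ Ideal.span (Set.range u)))) [𝔫'.IsPrime],
      ¬ Ideal.span (Set.range (MvPolynomial.X : Fin d → MvPolynomial (Fin d) (S ⧸ Ideal.span (Set.range u)))) ≤ 𝔫' →
      algebraMap (MvPolynomial (Fin d) (S ⧸ Ideal.span (Set.range u))) (Localization.AtPrime 𝔫')
        (rho u w hu hd hw (transform u w hu hw Δ a m hN hr)) ∉ maximalIdeal (Localization.AtPrime 𝔫') ^ ν) :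
    ∀ (𝔫 : Ideal (extReesAlgebra (weightedMonomialIdeal u w))) [𝔫.IsPrime],
      extReesAlgebra.tInv (weightedMonomialIdeal u w) ∈ 𝔫 →
      (maximalIdeal S).map (algebraMap S (extReesAlgebra (weightedMonomialIdeal u w))) ≤ 𝔫 →
      ¬ (extReesAlgebra.vertexIdeal (weightedMonomialIdeal u w) ≤ 𝔫) →
      ∀ (a' : ℕ) (g : extReesAlgebra (weightedMonomialIdeal u w)),
        algebraMap S (extReesAlgebra (weightedMonomialIdeal u w)) f =
          extReesAlgebra.tInv (weightedMonomialIdeal u w) ^ a' * g →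
        ¬ (extReesAlgebra.tInv (weightedMonomialIdeal u w) ∣ g) →
        algebraMap (extReesAlgebra (weightedMonomialIdeal u w)) (Localization.AtPrime 𝔫) g ∈
          (maximalIdeal (Localization.AtPrime 𝔫)) ^ 2 →
        iotaOrd (Localization.AtPrime 𝔫)
          (algebraMap (extReesAlgebra (weightedMonomialIdeal u w)) (Localization.AtPrime 𝔫) g) < ν := by
  intro 𝔫 _ hT _ hV a' g hfg hndvd _
  haveI := nbar_isPrime u w hu hd hw 𝔫 hT
  have hV' := not_span_X_le_nbar u w hu hd hw 𝔫 hT hV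
  have hΦ := hface (nbar u w hu hd hw 𝔫) hV'
  have hΦ0 : rho u w hu hd hw (transform u w hu hw Δ a m hN hr) ≠ 0 := by
    intro h0
    apply hΦ
    rw [h0, map_zero]
    exact Ideal.zero_mem _
  obtain ⟨-, rfl⟩ := transform_unique u w hu hd hw Δ a m hN hr hm hmN hf hΦ0 hfg hndvd
  refine lt_of_le_of_lt (iotaOrd_localization_le_of_comap_eq (rho u w hu hd hw) 𝔫 (nbar u w hu hd hw 𝔫)
    (comap_rho_nbar u w hu hd hw 𝔫 hT).symm _) ?_
  exact LocalGameEFTFace.iotaOrd_lt_of_notMem_pow hΦ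

end LocalGameEFTPointMove

end Summit.ResolutionOfSingularities.ResolutionOfSingularities.Theorems

end
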